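import Literature.Geometry.Symplectic.NearSymplecticAdaptedFrame
import Mathlib.LinearAlgebra.CrossProduct
import HarnessLib

/-!
# Rotating the normal frame and the self-dual triple

Topic `Geometry/Symplectic`; namespace `Literature.Geometry.Symplectic`.  No `sorry`, no named
fact.  The adapted frames of `NearSymplecticAdaptedFrame.lean` (`η_k(Au, Av) = c β_k(u, v)` for
the standard self-dual triple `β_k` of `ℝ_θ × ℝ³`) are acted on by `SO(3)`: rotating the three
NORMAL coordinates by the rotation with orthonormal columns `f₀, f₁, f₂`, `f₀ × f₁ = f₂`, while
fixing the axis coordinate (`rotateNormal`), the triple `β_k` transforms by the rotation itself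
(`hondaBetaVec_rotateNormal`: `β(R̄u, R̄v) = Σ_m β_m(u, v) f_m`, from `(Ra) × (Rb) = R(a × b)`,
`cross_sum_smul_frame`); hence the rotated triple `η'_m = Σ_k (f_m)_k η_k` is again
wedge-orthonormal (`IsWedgeOrthonormalTriple.rotate_triple`), it is adapted to the rotated frame
`A ∘ R̄` (`rotate_frame_relation`), and expansions against the triple rotate accordingly
(`pfaffianPair_rotate_triple`, `eq_sum_smul_rotate_triple`).  This is the freedom "choose the
orthonormal frame `(e₁, e₂, e₃)` of `N_{Z/X}` with `e₃` spanning `L⁻`" of Perutz 2006, §3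
(proof of Lemma 3.1, step 1).

## References

* T. Perutz, *Zero-sets of near-symplectic forms*, J. Symplectic Geom. 4 (2006), §2 eq. (1) and
  §3. [Perutz2006]
-/

noncomputable section

open Set Function Module Literature.Geometry.Kaehler Literature.Topology.FourManifolds
open scoped Matrix

namespace Literature.Geometry.Symplectic

/-! ### Normal parts, lifts and the rotation of the normal coordinates -/

/-- The normal part `(U₁, U₂, U₃)` of a vector of `ℝ_θ × ℝ³`. [folklore] -/
def normalPart (U : EuclideanSpace ℝ (Fin 4)) : Fin 3 → ℝ := fun k ↦ U k.succ

/-- The normal vector `(0, a₀, a₁, a₂)` with prescribed normal part. [folklore] -/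
def normalLift (a : Fin 3 → ℝ) : EuclideanSpace ℝ (Fin 4) := ∑ k, a k • stdVec k.succ

/-- **Rotation of the normal coordinates** by the matrix with columns `f₀, f₁, f₂`, fixing the
axis coordinate: `R̄ U = (U₀, Σ_m U_{m+1} f_m)`, as a continuous linear map.
[cite: Perutz2006, §3 (proof of Lemma 3.1, step 1)] -/
def rotateNormal (f : Fin 3 → Fin 3 → ℝ) : EuclideanSpace ℝ (Fin 4) →L[ℝ] EuclideanSpace ℝ (Fin 4) :=
  (EuclideanSpace.proj (0 : Fin 4)).smulRight (stdVec 0) +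
    ∑ m, (EuclideanSpace.proj (Fin.succ m)).smulRight (normalLift (f m))

/-- The vector `(β₁(U,V), β₂(U,V), β₃(U,V))` of values of the standard self-dual triple.
[cite: Perutz2006, §2 eq. (1)] -/
def hondaBetaVec (U V : EuclideanSpace ℝ (Fin 4)) : Fin 3 → ℝ :=
  ![hondaBeta₁ ![U, V], hondaBeta₂ ![U, V], hondaBeta₃ ![U, V]]

/-- Components of the normal part. [folklore] -/
@[simp] theorem normalPart_apply (U : EuclideanSpace ℝ (Fin 4)) (k : Fin 3) :
    normalPart U k = U k.succ := rfl

/-- The axis component of a lift vanishes. [folklore] -/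
@[simp] theorem normalLift_apply_zero (a : Fin 3 → ℝ) : normalLift a 0 = 0 := by
  simp [normalLift, Fin.sum_univ_three, stdVec]

/-- The normal components of a lift. [folklore] -/
@[simp] theorem normalLift_apply_succ (a : Fin 3 → ℝ) (k : Fin 3) : normalLift a k.succ = a k := by
  fin_cases k <;> simp [normalLift, Fin.sum_univ_three, stdVec]

/-- The first normal component of a lift. [folklore] -/
@[simp] theorem normalLift_apply_one (a : Fin 3 → ℝ) : normalLift a 1 = a 0 :=
  normalLift_apply_succ a 0

/-- The second normal component of a lift. [folklore] -/
@[simp] theorem normalLift_apply_two (a : Fin 3 → ℝ) : normalLift a 2 = a 1 :=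
  normalLift_apply_succ a 1

/-- The third normal component of a lift. [folklore] -/
@[simp] theorem normalLift_apply_three (a : Fin 3 → ℝ) : normalLift a 3 = a 2 :=
  normalLift_apply_succ a 2

/-- The normal part of a lift. [folklore] -/
@[simp] theorem normalPart_normalLift (a : Fin 3 → ℝ) : normalPart (normalLift a) = a := by
  funext k; simp

/-- The rotation, unfolded. [folklore] -/
theorem rotateNormal_apply (f : Fin 3 → Fin 3 → ℝ) (U : EuclideanSpace ℝ (Fin 4)) :
    rotateNormal f U = U 0 • stdVec 0 + ∑ m, U m.succ • normalLift (f m) := by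
  simp [rotateNormal]

/-- The axis coordinate is fixed by the rotation. [folklore] -/
@[simp] theorem rotateNormal_apply_zero (f : Fin 3 → Fin 3 → ℝ) (U : EuclideanSpace ℝ (Fin 4)) :
    rotateNormal f U 0 = U 0 := by
  simp [rotateNormal_apply, stdVec, Fin.sum_univ_three]

/-- The normal components of the rotated vector: `(R̄U)_{k+1} = Σ_m U_{m+1} (f_m)_k`. [folklore] -/
@[simp] theorem rotateNormal_apply_succ (f : Fin 3 → Fin 3 → ℝ) (U : EuclideanSpace ℝ (Fin 4))
    (k : Fin 3) : rotateNormal f U k.succ = ∑ m, U m.succ * f m k := by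
  fin_cases k <;> simp [rotateNormal_apply, stdVec, Fin.sum_univ_three]

/-- The normal part of the rotated vector: `Σ_m U_{m+1} f_m`. [folklore] -/
theorem normalPart_rotateNormal (f : Fin 3 → Fin 3 → ℝ) (U : EuclideanSpace ℝ (Fin 4)) :
    normalPart (rotateNormal f U) = ∑ m, U m.succ • f m := by
  funext k
  rw [normalPart_apply, rotateNormal_apply_succ, Finset.sum_apply]
  simp

/-- The rotation fixes the axis vector `e₀`. [folklore] -/
@[simp] theorem rotateNormal_stdVec_zero (f : Fin 3 → Fin 3 → ℝ) :
    rotateNormal f (stdVec 0) = stdVec 0 := by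
  rw [rotateNormal_apply]
  simp [stdVec, Fin.succ_ne_zero]

/-! ### Orthonormal frames of `ℝ³` -/

variable {f : Fin 3 → Fin 3 → ℝ}

/-- Column orthonormality from row orthonormality (`M Mᵀ = 1 ⇒ Mᵀ M = 1`). [folklore] -/
theorem sum_mul_mul_eq_ite (horth : ∀ i j, f i ⬝ᵥ f j = if i = j then 1 else 0) (k l : Fin 3) :
    ∑ m, f m k * f m l = if k = l then 1 else 0 := by
  have h1 : Matrix.of f * (Matrix.of f)ᵀ = 1 := by
    ext i j
    rw [Matrix.mul_apply, Matrix.one_apply, ← horth i j, dotProduct]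
    rfl
  have h2 : (Matrix.of f)ᵀ * Matrix.of f = 1 := mul_eq_one_comm.1 h1
  have h3 := congrFun (congrFun h2 k) l
  rw [Matrix.mul_apply, Matrix.one_apply] at h3
  simpa [Matrix.transpose_apply] using h3

/-- The inverse rotation is the rotation by the transposed frame. [folklore] -/
theorem rotateNormal_transpose_rotateNormal
    (horth : ∀ i j, f i ⬝ᵥ f j = if i = j then 1 else 0) (U : EuclideanSpace ℝ (Fin 4)) :
    rotateNormal (fun m k ↦ f k m) (rotateNormal f U) = U := by
  have hrow : ∀ n k, ∑ m, f n m * f k m = if n = k then 1 else 0 := fun n k ↦ by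
    rw [← horth n k, dotProduct]
  refine PiLp.ext fun i ↦ ?_
  refine Fin.cases ?_ (fun k ↦ ?_) i
  · simp
  · rw [rotateNormal_apply_succ]
    simp only [rotateNormal_apply_succ, Finset.sum_mul]
    rw [Finset.sum_comm]
    simp only [mul_assoc, ← Finset.mul_sum, hrow, mul_ite, mul_one, mul_zero,
      Finset.sum_ite_eq', Finset.mem_univ, if_true]

/-- The rotation followed by the transposed rotation is the identity. [folklore] -/
theorem rotateNormal_rotateNormal_transpose
    (horth : ∀ i j, f i ⬝ᵥ f j = if i = j then 1 else 0) (U : EuclideanSpace ℝ (Fin 4)) :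
    rotateNormal f (rotateNormal (fun m k ↦ f k m) U) = U := by
  have hcol := sum_mul_mul_eq_ite horth
  refine PiLp.ext fun i ↦ ?_
  refine Fin.cases ?_ (fun k ↦ ?_) i
  · simp
  · rw [rotateNormal_apply_succ]
    simp only [rotateNormal_apply_succ, Finset.sum_mul]
    rw [Finset.sum_comm]
    have : ∀ x, ∑ m, U x.succ * f m x * f m k = U x.succ * ∑ m, f m x * f m k := fun x ↦ by
      rw [Finset.mul_sum]; refine Finset.sum_congr rfl fun m _ ↦ by ring
    simp only [this, hcol, mul_ite, mul_one, mul_zero, Finset.sum_ite_eq', Finset.mem_univ,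
      if_true]

/-- **The rotation as a linear automorphism of `ℝ⁴`** (inverse: the transposed rotation).
[folklore] -/
def rotateNormalEquiv (f : Fin 3 → Fin 3 → ℝ)
    (horth : ∀ i j, f i ⬝ᵥ f j = if i = j then 1 else 0) :
    EuclideanSpace ℝ (Fin 4) ≃L[ℝ] EuclideanSpace ℝ (Fin 4) :=
  ContinuousLinearEquiv.equivOfInverse (rotateNormal f) (rotateNormal fun m k ↦ f k m)
    (rotateNormal_transpose_rotateNormal horth) (rotateNormal_rotateNormal_transpose horth)

/-- The rotation equivalence, unfolded. [folklore] -/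
@[simp] theorem rotateNormalEquiv_apply (horth : ∀ i j, f i ⬝ᵥ f j = if i = j then 1 else 0)
    (U : EuclideanSpace ℝ (Fin 4)) : rotateNormalEquiv f horth U = rotateNormal f U := rfl

/-- **`(Σ aₘ fₘ) × (Σ bₙ fₙ) = Σ (a × b)ₘ fₘ`** for an orthonormal frame with `f₀ × f₁ = f₂`
(then also `f₁ × f₂ = f₀`, `f₂ × f₀ = f₁`). [folklore] -/
theorem cross_sum_smul_frame (horth : ∀ i j, f i ⬝ᵥ f j = if i = j then 1 else 0)
    (hcross : f 0 ⨯₃ f 1 = f 2) (a b : Fin 3 → ℝ) :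
    (∑ m, a m • f m) ⨯₃ (∑ n, b n • f n) = ∑ m, (a ⨯₃ b) m • f m := by
  have h00 : f 0 ⬝ᵥ f 0 = 1 := by rw [horth]; simp
  have h11 : f 1 ⬝ᵥ f 1 = 1 := by rw [horth]; simp
  have h01 : f 0 ⬝ᵥ f 1 = 0 := by rw [horth]; simp
  have h12 : f 1 ⨯₃ f 2 = f 0 := by
    rw [← hcross, cross_cross_eq_smul_sub_smul', h11, h01, one_smul, zero_smul, sub_zero]
  have h20 : f 2 ⨯₃ f 0 = f 1 := by
    rw [← cross_anticomm, ← hcross, cross_cross_eq_smul_sub_smul', h01, h00, zero_smul,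
      one_smul, zero_sub, neg_neg]
  have h10 : f 1 ⨯₃ f 0 = -f 2 := by rw [← cross_anticomm, hcross]
  have h21 : f 2 ⨯₃ f 1 = -f 0 := by rw [← cross_anticomm, h12]
  have h02 : f 0 ⨯₃ f 2 = -f 1 := by rw [← cross_anticomm, h20]
  simp only [Fin.sum_univ_three, map_add, map_smul, LinearMap.add_apply, LinearMap.smul_apply,
    cross_self, hcross, h12, h20, h10, h21, h02, cross_apply]
  simp only [Matrix.cons_val_zero, Matrix.cons_val_one, Matrix.cons_val, smul_zero, smul_neg]
  module

/-! ### The self-dual triple under the rotation -/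

/-- **The standard self-dual triple as "`dt ∧ dx + ⋆(dt ∧ dx)`"**:
`β(U, V) = U₀ V_N − V₀ U_N + U_N × V_N` (normal parts `U_N, V_N`). [cite: Perutz2006, §2 eq. (1)] -/
theorem hondaBetaVec_eq (U V : EuclideanSpace ℝ (Fin 4)) :
    hondaBetaVec U V = U 0 • normalPart V - V 0 • normalPart U + normalPart U ⨯₃ normalPart V := by
  funext k
  fin_cases k <;> simp [hondaBetaVec, cross_apply, normalPart] <;> ring

/-- **The self-dual triple rotates with the normal frame**: `β(R̄U, R̄V) = Σ_m β_m(U, V) f_m`.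
[cite: Perutz2006, §3 (proof of Lemma 3.1, step 1)] -/
theorem hondaBetaVec_rotateNormal (horth : ∀ i j, f i ⬝ᵥ f j = if i = j then 1 else 0)
    (hcross : f 0 ⨯₃ f 1 = f 2) (U V : EuclideanSpace ℝ (Fin 4)) :
    hondaBetaVec (rotateNormal f U) (rotateNormal f V) = ∑ m, hondaBetaVec U V m • f m := by
  rw [hondaBetaVec_eq, normalPart_rotateNormal, normalPart_rotateNormal, rotateNormal_apply_zero,
    rotateNormal_apply_zero, cross_sum_smul_frame horth hcross]
  have hm : ∀ m, hondaBetaVec U V m =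
      U 0 * V m.succ - V 0 * U m.succ + ((fun k : Fin 3 ↦ U k.succ) ⨯₃ fun k ↦ V k.succ) m := by
    intro m
    have h := congrFun (hondaBetaVec_eq U V) m
    simp only [Pi.add_apply, Pi.sub_apply, Pi.smul_apply, smul_eq_mul, normalPart_apply] at h
    exact h
  simp only [hm, add_smul, sub_smul, Finset.sum_add_distrib, Finset.sum_sub_distrib, mul_smul,
    ← Finset.smul_sum]

/-- The same, componentwise: `β_k(R̄U, R̄V) = Σ_m (f_m)_k β_m(U, V)`. [folklore] -/
theorem hondaBetaVec_rotateNormal_apply (horth : ∀ i j, f i ⬝ᵥ f j = if i = j then 1 else 0)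
    (hcross : f 0 ⨯₃ f 1 = f 2) (U V : EuclideanSpace ℝ (Fin 4)) (k : Fin 3) :
    hondaBetaVec (rotateNormal f U) (rotateNormal f V) k = ∑ m, f m k * hondaBetaVec U V m := by
  rw [hondaBetaVec_rotateNormal horth hcross, Finset.sum_apply]
  exact Finset.sum_congr rfl fun m _ ↦ by simp [mul_comm]

/-! ### Rotating a wedge-orthonormal triple -/

variable {η : Fin 3 → (EuclideanSpace ℝ (Fin 4)) [⋀^Fin 2]→L[ℝ] ℝ} {s : ℝ}

/-- Pairing against a rotated triple member: `⟨ζ, Σ_k (f_m)_k η_k⟩ = Σ_k (f_m)_k ⟨ζ, η_k⟩`.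
[folklore] -/
theorem pfaffianPair_rotate_triple (ζ : (EuclideanSpace ℝ (Fin 4)) [⋀^Fin 2]→L[ℝ] ℝ)
    (a : Fin 3 → ℝ) : pfaffianPair ζ (∑ k, a k • η k) = ∑ k, a k * pfaffianPair ζ (η k) := by
  rw [pfaffianPair_comm, pfaffianPair_sum_smul_left]
  exact Finset.sum_congr rfl fun k _ ↦ by rw [pfaffianPair_comm]

/-- Gram matrix of the rotated triple: `⟨η'_m, η'_n⟩ = 2s (f_m · f_n)`. [folklore] -/
theorem pfaffianPair_rotate_rotate (hW : IsWedgeOrthonormalTriple (η 0) (η 1) (η 2) s)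
    (m n : Fin 3) :
    pfaffianPair (∑ k, f m k • η k) (∑ l, f n l • η l) = 2 * s * (f m ⬝ᵥ f n) := by
  rw [pfaffianPair_sum_smul_left]
  simp only [pfaffianPair_rotate_triple, hW.pfaffianPair_eq_ite, mul_ite, mul_zero,
    Finset.sum_ite_eq, Finset.mem_univ, if_true]
  rw [dotProduct, Finset.mul_sum]
  exact Finset.sum_congr rfl fun k _ ↦ by ring

/-- **A wedge-orthonormal triple rotated by an orthonormal frame is wedge-orthonormal.**
[cite: Perutz2006, Lemma 2.1 (b)] -/
theorem IsWedgeOrthonormalTriple.rotate_triple (hW : IsWedgeOrthonormalTriple (η 0) (η 1) (η 2) s)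
    (horth : ∀ i j, f i ⬝ᵥ f j = if i = j then 1 else 0) :
    IsWedgeOrthonormalTriple (∑ k, f 0 k • η k) (∑ k, f 1 k • η k) (∑ k, f 2 k • η k) s := by
  have hs0 : s ≠ 0 := hW.p_ne
  have hG := pfaffianPair_rotate_rotate (f := f) hW
  have hpf : ∀ m, pfaffian (∑ k, f m k • η k) = s := fun m ↦ by
    have h := hG m m
    rw [pfaffianPair_self, horth, if_pos rfl, mul_one] at h
    linarith
  refine ⟨hs0, hpf 0, hpf 1, hpf 2, ?_, ?_, ?_⟩
  · rw [hG, horth]; simp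
  · rw [hG, horth]; simp
  · rw [hG, horth]; simp

/-- Evaluation of a rotated triple member. [folklore] -/
theorem sum_smul_alt_apply (a : Fin 3 → ℝ) (x : Fin 2 → EuclideanSpace ℝ (Fin 4)) :
    (∑ k, a k • η k) x = ∑ k, a k * η k x := by
  simp [ContinuousAlternatingMap.sum_apply]

/-- **The rotated triple is adapted to the rotated frame**: if `η_k(Au, Av) = c β_k(u, v)` for
all `k`, then `η'_m(A R̄u, A R̄v) = c β_m(u, v)` for `η'_m = Σ_k (f_m)_k η_k`.
[cite: Perutz2006, §3 (proof of Lemma 3.1, step 1)] -/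
theorem rotate_frame_relation (horth : ∀ i j, f i ⬝ᵥ f j = if i = j then 1 else 0)
    (hcross : f 0 ⨯₃ f 1 = f 2) {A : EuclideanSpace ℝ (Fin 4) → EuclideanSpace ℝ (Fin 4)}
    {c : ℝ} (hη : ∀ k u v, η k ![A u, A v] = c * hondaBetaVec u v k) (m : Fin 3)
    (u v : EuclideanSpace ℝ (Fin 4)) :
    (∑ k, f m k • η k) ![A (rotateNormal f u), A (rotateNormal f v)] = c * hondaBetaVec u v m := by
  rw [sum_smul_alt_apply]
  simp only [hη, hondaBetaVec_rotateNormal_apply horth hcross, Finset.mul_sum]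
  -- `Σ_k f m k * (c * Σ_n f n k * β_n) = c * Σ_n (Σ_k f m k f n k) β_n = c β_m`
  have hrow : ∀ n, ∑ k, f m k * f n k = if m = n then 1 else 0 := fun n ↦ by
    rw [← horth m n, dotProduct]
  calc ∑ k, ∑ n, f m k * (c * (f n k * hondaBetaVec u v n))
      = ∑ n, c * hondaBetaVec u v n * ∑ k, f m k * f n k := by
        rw [Finset.sum_comm]
        simp only [Finset.mul_sum]
        exact Finset.sum_congr rfl fun n _ ↦ Finset.sum_congr rfl fun k _ ↦ by ring
    _ = c * hondaBetaVec u v m := by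
        simp only [hrow, mul_ite, mul_one, mul_zero, Finset.sum_ite_eq, Finset.mem_univ, if_true]

/-- **Inverse rotation of the triple**: `η_k = Σ_m (f_m)_k η'_m` (column orthonormality).
[folklore] -/
theorem eq_sum_smul_rotate_triple (horth : ∀ i j, f i ⬝ᵥ f j = if i = j then 1 else 0)
    (k : Fin 3) : η k = ∑ m, f m k • ∑ l, f m l • η l := by
  have hcol := sum_mul_mul_eq_ite horth
  simp only [Finset.smul_sum, smul_smul]
  rw [Finset.sum_comm]
  have : ∀ l, ∑ m, (f m k * f m l) • η l = (if k = l then (1 : ℝ) else 0) • η l := fun l ↦ by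
    rw [← Finset.sum_smul, hcol]
  simp only [this, ite_smul, one_smul, zero_smul, Finset.sum_ite_eq, Finset.mem_univ, if_true]

/-- **Re-expansion against the rotated triple**: a combination `Σ_k a_k η_k` equals
`Σ_m (Σ_k (f_m)_k a_k) η'_m`. [folklore] -/
theorem sum_smul_eq_sum_rotate_triple (horth : ∀ i j, f i ⬝ᵥ f j = if i = j then 1 else 0)
    (a : Fin 3 → ℝ) :
    ∑ k, a k • η k = ∑ m, (∑ k, f m k * a k) • ∑ l, f m l • η l := by
  calc ∑ k, a k • η k = ∑ k, a k • ∑ m, f m k • ∑ l, f m l • η l :=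
        Finset.sum_congr rfl fun k _ ↦ by rw [← eq_sum_smul_rotate_triple horth k]
    _ = ∑ m, (∑ k, f m k * a k) • ∑ l, f m l • η l := by
        simp only [Finset.smul_sum, smul_smul, Finset.sum_mul, Finset.sum_smul]
        rw [Finset.sum_comm]
        refine Finset.sum_congr rfl fun m _ ↦ ?_
        rw [Finset.sum_comm]
        refine Finset.sum_congr rfl fun l _ ↦ Finset.sum_congr rfl fun k _ ↦ ?_
        congr 1
        ring

end Literature.Geometry.Symplectic

end
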